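import Literature.MathematicalPhysics.QuantumFieldTheory.Balaban1983to89.Node00.CriticalOnFibreTop

/-!
# NODE 00 — ROW P11: [15] THEOREM 1 (9), LINE 1 («there exists a gauge transformation u … |A|, |∇^ηA| < B₃Mε₁(L^jη)^{−1,−2}») FOR CRITICAL
# CONFIGURATIONS, AT THE OBJECTS OF RECORD — the NAMED FACT `Gauge9RegSepTopStep F N Sup M B₃ B₃' a₀ a₁` (Prop-8 STEP currency, top domain, scale-n units),
# the chart to [I] (1.12)'s `∃ u ∃ A` currency, the minimiser form, and the reduction to Prop. 8 ∧ the gauge-fixing half ([15] (152) = [6] Thm 2 on the cube)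

Cell `pub-ymgap`, seat `pub-ymgap-dag-n07-e` generation 9 (R141 (C), DAG node N07 = [15]; INBOX LOCATED-M6 + INTENT-23 of 2026-08-27 ≈12:22Z).
NEW leaf; this seat's `Node00.CriticalOnFibreTop` (p524052: `Prop8RegSepTopStep`, `isCritOnFibre_of_isMinimizer_classTop`) and, through it, node00-def-P11's
FILE 12a (`Sect2.omegaPlaqsTop`, `CoDivClassOnTop`, `DataSmall7PTop`), FILE 4 (`expI_log_eq`, `gaugeU_ιSU`), def-R's `cubeEnl` and r11's `B12RegularSpaces111`
letters (`gaugeU`, `expI`, `grad`) are CONSUMED BY NAME, nothing modified.  `--kind definition --supports stmt-QuantumFields-20506` (K0⁶, WORDS-142).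
[15] = [Balaban1985Variational]; [6] = [Balaban1985RegularSpaces]; [I] = [Balaban1987RG1]; [III] = [Balaban1988Convergent].

WHY (LOCATED-M6, this seat, cell bus 2026-08-27).  [I] (1.12) p. 262 ∕ [III] (2.38)(ii) p. 261 ask, on every cube `□` of a localization domain, for SOME
`G`-valued gauge `u` with `U^u = exp iξA`, `|A|, |∇^ξA| < O(1)LMB·α₀` (tree: `B12RegularSpaces111.CondI.localGauge : ∃ u, … ∃ A, …`, EXISTENTIAL in `u`).
For Bałaban's background fields that witness is the gauge `u` OF [15] Theorem 1 (9) itself — LINE 1 of (9): `|A| < B₃Mε₁(L^jη)⁻¹`, `|∇^ηA| < B₃Mε₁(L^jη)⁻²`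
in the gauge `u` of [6] Thm 2 ((152)–(153) p. 301) — and nothing else of (9)–(10).  The K0 lane's road of record instead FIXES the witness to the axial (comb)
gauge of each cube (node00-def-P11 FILES 4∕5∕7a∕7c, `axialPotential`, `h3I`∕`h3MS`) and must then bound the TRANSVERSE gradient of the axial potential, which
needs the covariant difference of ADJACENT plaquette variables at size `b′·η_j³` (FILE 7a `norm_grad_axialPotential_le`: the staircase has `~ LM∕ξ` steps) —
a SUP-NORM bound on the covariant derivative of the curvature, typed as the second cited [15] sentence `VariationalThm1C1RegSep{Top7M,CoP7M}` (FILE 13).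
That bound is NOT in print: [15] (9)–(10) p. 279 and their proof (Sect. F, (152), (161), (164)–(167), (169)) bound `|A|`, `|∇A|`, the β-Hölder seminorm of
`∇A` (`β ≤ β₀`, constant `B₄(β₀)`) and the two second-order OPERATORS `|∂^{η*}∂^ηA|`, `|Δ^ηA|` — and [6] p. 83 L1–9 says of the identical block (1.36)∕(1.39):
«This condition describes fully regularity properties of the first order derivatives.  Such information is unavailable for the second order derivatives,
but we have the following bounds for the second order operators acting on A».  THIS FILE types the sentence print DOES state and the road DOES need —
(9) line 1, for CRITICAL configurations (Sect. F p. 300 L19–21: «we will use only the fact that they are critical configurations of the functional (5) and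
that they belong to the spaces (6) with ε₀ sufficiently small»), in the Prop-8 STEP currency of `Prop8RegSepTopStep` — so that a Theorem-1-level token
(def-P11's pen) and a row-body variant consuming `CondI.localGauge`'s own ∃-form (K0a's) have an N07-side sentence to key on, exactly as FILE 12d's
`…Top7M ∕ …CoP7M` key on `Prop8RegSepTopStep` (`Summits/…/BalabanUVNodesN07Thm1Top7FromProp8`).

THE SENTENCE (§2), IN SCALE-`n` UNITS (node00-def-P11 ANSWER-M6 (B): the two cube families its row body reads).  Binder block of
`Prop8RegSepTopStep F N Sup B₃ a₀ a₁` BYTE FOR BYTE (separated (2.18) index `s : SeqOfRecord F ν M g K k`, `0 < ν.M₁`, `1 ≤ k`, thresholds `0 < δ_n ≤ a₁`,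
`B₃δ_n ≤ ε₀ ≤ a₀`, comparable BOTH ways, datum with print's (7) on the top domain, `U` in the class (6)-Top at `ε₀` on the fibre of `W`, CRITICAL for (5) on that
fibre — except that the cube letter `M` of `s : SeqOfRecord F ν M g K k` is a parameter of the `Prop`), conclusion: for every scale `1 ≤ n ≤ k`, every side `S ∈ {Lⁿ·M, L^{n+1}·M}` (the [III] (2.38)(ii) layer cubes and the [I] (1.12) `O(1)LM`-cubes of record,
`B14.Eq213MaximalDomains.side`; `M` = [I]'s cube letter, a PARAMETER of the `Prop` — print's constant `B₃·M` is proportional to the cube size, so the bound is uniform only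
at fixed `M`) with `S < sitesPerDir` (no wrapping), every grid cube `□ = cubeEnl (F.P K) S a 0`,
`a ∈ cubeIndices (F.P K) S`, `□ ⊆ Ω_n`:  `∃ u : GaugeTransf (F.P K) 0 (SU N), ∃ A : PBond → M_N(ℂ)` with `(ιU)^{ιu}(b) = expI η_n (A b)` on the bonds of
`Sect2.regionOfSet □`, `‖A b‖ < B₃'·δ_n` there, `‖grad η_n μ A_ν x‖ < B₃'·δ_n` on its derivative quadruples — print's `U^u = e^{iηA}`, `|A| < B₃Mε₁(L^jη)⁻¹`,
`|∇^ηA| < B₃Mε₁(L^jη)⁻²` at `L^jη = 1`, `ε₁ ↦ δ_n`.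
HONEST LABEL.  VERBATIM (9) LINE 1 modulo: (a) units; (b) cube class — print states (9) on the cubes of pp. 278–279 (side `2MLⁿη`, `M` a multiple of `R₁M₁`,
`M ≤ M(ε₁) = R₁M₁a₁∕ε₁`, the concentric `(2M + 4R₁M₁)Lⁿη`-cube inside `B_n(Λ_n) ∪ B_{n+1}(Λ_{n+1}) = Ω_n ∖ Ω_{n+2}` and not inside `B_{n+1}(Λ_{n+1})`); a
non-wrapping grid cube inside `Ω_n` WITHOUT that collar is covered by a class cube of scale `n − 1` (one-scale factors `L`, `L²` and `δ_{n−1} ≤ 2δ_n` absorbed) or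
of a deeper scale `m > n` (factors `(2∕L)^{m−n} ≤ 1`), and restricting `u` to a sub-cube keeps the bounds; `B₃'` ABSORBS print's `B₃·M` (layer cubes) resp.
`B₃·LM` ((1.12) cubes) and these factors, `a₁` absorbs `M ≤ M(ε₁)`; (c) criticality in the CURVE form (`IsCritOnFibre`), print's Sect. F uses the (82) tangent
form — GAP-STATED(submersion), ref-C READ-121 NOTE 2, as for `Prop8RegSepTopStep`; (d) the Hölder member of (9) and (10) are NOT part of this sentence (no consumer
on the (1.12)∕(2.38)(ii) road reads them; (10)'s operators are what print has INSTEAD of a curvature-derivative bound).  A `Prop` with parameters, NEVER asserted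
here.  Expected inhabitation floor (print: «positive constants»): `0 < B₃'`; consumers display `2L² ≤ B₃` for the companion (8)-sentence.

CONTENTS.  §1 chart algebra in a complete normed `ℂ`-algebra: private `norm_pow_sub_pow_le_half'`, `norm_logOnePlus_sub_logOnePlus_le'` (the logarithmic chart
is 4-Lipschitz on the half-ball; re-proved — FILE 7a's copies are private), ★ `chart_of_groupBounds` (unit `g`, `‖g − 1‖ ≤ r ≤ ½` ⇒ `A := (iξ)⁻¹log g` has
`exp iξA = g`, `‖A‖ ≤ 2r∕ξ`; two such units ⇒ `‖A − A′‖ ≤ 4‖g − g′‖∕ξ`).  §2 ★★ `Gauge9RegSepTopStep` (NAMED FACT), `.of_le` (antitone in `a₀`, `a₁`), `.mono`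
(monotone in `B₃'`).  §3 ★ `gauge9_of_isMinimizer_classTop_of_gauge9TopStep` — the conclusion for every MINIMISER over the Top class
(`isCritOnFibre_of_isMinimizer_classTop`; node00-def-P11's Theorem-1-level `VariationalThm1GaugeRegSep{Top7M,CoP7M}` keys on it), `dist1_su_eq_norm`, ★★
`localGauge_of_groupBounds` — from a GROUP-LEVEL small gauge on a site set (`dist1 (U^u b) < r₁ ≤ ½`, `‖U^u(x+e_μ,ν) − U^u(x,ν)‖ < r₂`) to the `∃ A` letters at any
chart scale `ξ` (`‖A‖ ≤ 2r₁∕ξ`, `‖grad ξ A‖ ≤ 4r₂∕ξ²`) — the passage a future discharge of the fact from a gauge CONSTRUCTION ([6] Thm 2) takes.  §4 the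
GAUGE-FIXING HALF: ★★ `Gauge152OfClassTopStep F N Sup M B₉ a₀` (NAMED FACT: [15] (152) p.301 line 1 = [6] Thm 2 applied to `(U′_k, 1)` on the collared cube, for
configurations IN THE CLASS (2)∕(6)-Top — no criticality, no datum), `.of_le`, and ★★★ `gauge9RegSepTopStep_of_prop8TopStep_of_gauge152` — print's order of proof in
Sect. F: `Gauge9RegSepTopStep F N Sup M B₃ (B₉·B₃) a₀ a₁ ⟸ Prop8RegSepTopStep F N Sup B₃ a₀ a₁ ∧ Gauge152OfClassTopStep F N Sup M B₉ a₀'` (`0 < B₃`, `B₃a₁ ≤ a₀'`), so that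
on the K0 road N07's own analytic debt is [15] Prop. 8 and the (9) half is the [B8]-node's Thm 2 applied locally.

HONEST FRAMING: two named facts (`Prop`s, never asserted) + kernel bookkeeping (a power-series estimate and a chart); nothing of Bałaban proved; N07 ∕ K0⁶ NOT
discharged; counts unmoved (5∕27); one finite T⁴ programme at fixed ε — NOT continuum ∕ ℝ⁴ ∕ OS ∕ mass gap ∕ Clay.  No `sorry`, no `instance`, no `notation`.
-/

noncomputable section

namespace Literature.MathematicalPhysics.QuantumFieldTheory.Balaban1983to89.Node00

open Filter Topology
open Complex (I)
open T4Continuum (T4Family)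
open B15DeterminingSets B12RegularSpaces111
open Literature.Analysis.Complex (logOnePlus logSeriesCoeff hasSum_logOnePlus norm_logSeriesCoeff_le)
open scoped Matrix.Norms.L2Operator

/-! ## §1  The chart: group-level smallness ⇒ a potential `A` with `exp iξA = g`, `|A|` and differences of `A` controlled -/

section Chart

variable {𝔸 : Type*} [NormedRing 𝔸] [NormedAlgebra ℂ 𝔸] [CompleteSpace 𝔸]

omit [NormedAlgebra ℂ 𝔸] [CompleteSpace 𝔸] in
/-- `‖xⁿ − yⁿ‖ ≤ 2n(½)ⁿ‖x − y‖` on the half-ball (`‖x‖, ‖y‖ ≤ ½`). [folklore] -/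
private theorem norm_pow_sub_pow_le_half' {x y : 𝔸} (hx : ‖x‖ ≤ 1 / 2) (hy : ‖y‖ ≤ 1 / 2) :
    ∀ n : ℕ, ‖x ^ n - y ^ n‖ ≤ 2 * ((n : ℝ) * (1 / 2 : ℝ) ^ n) * ‖x - y‖
  | 0 => by simp
  | n + 1 => by
    rcases Nat.eq_zero_or_pos n with rfl | hn
    · simp only [zero_add, pow_one, Nat.cast_one, one_mul]; norm_num
    have ih := norm_pow_sub_pow_le_half' hx hy n
    have hid : x ^ (n + 1) - y ^ (n + 1) = (x ^ n - y ^ n) * y + x ^ n * (x - y) := by rw [pow_succ, pow_succ]; noncomm_ring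
    rw [hid]
    have hxn : ‖x ^ n‖ ≤ (1 / 2 : ℝ) ^ n := (norm_pow_le' x hn).trans (pow_le_pow_left₀ (norm_nonneg _) hx n)
    have hD := norm_nonneg (x - y)
    calc ‖(x ^ n - y ^ n) * y + x ^ n * (x - y)‖ ≤ ‖x ^ n - y ^ n‖ * ‖y‖ + ‖x ^ n‖ * ‖x - y‖ :=
          (norm_add_le _ _).trans (add_le_add (norm_mul_le _ _) (norm_mul_le _ _))
      _ ≤ (2 * ((n : ℝ) * (1 / 2 : ℝ) ^ n) * ‖x - y‖) * (1 / 2) + (1 / 2 : ℝ) ^ n * ‖x - y‖ := by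
          gcongr
      _ = 2 * (((n + 1 : ℕ) : ℝ) * (1 / 2 : ℝ) ^ (n + 1)) * ‖x - y‖ := by push_cast; ring

/-- **THE LOGARITHMIC CHART IS 4-LIPSCHITZ ON THE HALF-BALL**: `‖log(1 + x) − log(1 + y)‖ ≤ 4‖x − y‖` for `‖x‖, ‖y‖ ≤ ½`. [folklore] -/
private theorem norm_logOnePlus_sub_logOnePlus_le' {x y : 𝔸} (hx : ‖x‖ ≤ 1 / 2) (hy : ‖y‖ ≤ 1 / 2) :
    ‖logOnePlus x - logOnePlus y‖ ≤ 4 * ‖x - y‖ := by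
  have hx1 : ‖x‖ < 1 := hx.trans_lt (by norm_num)
  have hy1 : ‖y‖ < 1 := hy.trans_lt (by norm_num)
  have hsum : HasSum (fun n : ℕ => logSeriesCoeff n • (x ^ n - y ^ n)) (logOnePlus x - logOnePlus y) := by
    have := (hasSum_logOnePlus hx1).sub (hasSum_logOnePlus hy1)
    simpa only [smul_sub] using this
  have hgeom : HasSum (fun n : ℕ => 2 * ((n : ℝ) * (1 / 2 : ℝ) ^ n) * ‖x - y‖) (4 * ‖x - y‖) := by
    have h := hasSum_coe_mul_geometric_of_norm_lt_one (r := (1 / 2 : ℝ)) (by norm_num)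
    have h' := (h.mul_left 2).mul_right ‖x - y‖
    rwa [show (2 : ℝ) * (1 / 2 / (1 - 1 / 2) ^ 2) * ‖x - y‖ = 4 * ‖x - y‖ by norm_num] at h'
  refine hsum.norm_le_of_bounded hgeom fun n => ?_
  calc ‖logSeriesCoeff n • (x ^ n - y ^ n)‖ ≤ ‖logSeriesCoeff n‖ * ‖x ^ n - y ^ n‖ := norm_smul_le _ _
    _ ≤ 1 * (2 * ((n : ℝ) * (1 / 2 : ℝ) ^ n) * ‖x - y‖) :=
        mul_le_mul (norm_logSeriesCoeff_le n) (norm_pow_sub_pow_le_half' hx hy n) (norm_nonneg _) zero_le_one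
    _ = 2 * ((n : ℝ) * (1 / 2 : ℝ) ^ n) * ‖x - y‖ := one_mul _

/-- ★ **THE CHART `A := (iξ)⁻¹·log g` OF A UNIT NEAR `1`, WITH ITS DIFFERENCE BOUND**: for units `g, g′` with `‖g − 1‖, ‖g′ − 1‖ ≤ r ≤ ½` and `ξ > 0`:
`exp iξA = g`, `‖A‖ ≤ 2r∕ξ` (FILE 4 `expI_log_eq`), and `‖A − A′‖ ≤ 4‖g − g′‖∕ξ` (the 4-Lipschitz logarithm).  This is the passage from the group-level reading of
[15] Thm 1 (9) line 1 to print's `|A|`, `|∇A|` for `U^u = exp iξA`. [cite: Balaban1985Variational, Thm 1 (9) p.279 («U^u = e^{iηA}»); Balaban1987RG1, (1.12) p.262 (bookkeeping chart)] -/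
theorem chart_of_groupBounds {g g' : 𝔸ˣ} {r ξ : ℝ} (hg : ‖(g : 𝔸) - 1‖ ≤ r) (hg' : ‖(g' : 𝔸) - 1‖ ≤ r) (hr : r ≤ 1 / 2) (hξ : 0 < ξ) :
    expI ξ ((I * (ξ : ℂ))⁻¹ • logOnePlus ((g : 𝔸) - 1)) = g ∧ ‖(I * (ξ : ℂ))⁻¹ • logOnePlus ((g : 𝔸) - 1)‖ ≤ 2 * r / ξ ∧
      ‖(I * (ξ : ℂ))⁻¹ • logOnePlus ((g : 𝔸) - 1) - (I * (ξ : ℂ))⁻¹ • logOnePlus ((g' : 𝔸) - 1)‖ ≤ 4 * ‖(g : 𝔸) - (g' : 𝔸)‖ / ξ := by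
  refine ⟨(expI_log_eq hg hr hξ).1, (expI_log_eq hg hr hξ).2, ?_⟩
  rw [← smul_sub, norm_smul, norm_inv, norm_mul, Complex.norm_I, one_mul, Complex.norm_real, Real.norm_eq_abs, abs_of_pos hξ,
    inv_mul_le_iff₀ hξ]
  have h4 := norm_logOnePlus_sub_logOnePlus_le' (hg.trans hr) (hg'.trans hr)
  have hsub : (g : 𝔸) - 1 - ((g' : 𝔸) - 1) = (g : 𝔸) - (g' : 𝔸) := by abel
  rw [hsub] at h4
  calc ‖logOnePlus ((g : 𝔸) - 1) - logOnePlus ((g' : 𝔸) - 1)‖ ≤ 4 * ‖(g : 𝔸) - (g' : 𝔸)‖ := h4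
    _ = ξ * (4 * ‖(g : 𝔸) - (g' : 𝔸)‖ / ξ) := by field_simp

end Chart

/-! ## §2  ★★ [15] Theorem 1 (9), line 1, for critical configurations, at the objects of record — the named fact -/

section NamedFactGauge9Top

variable (F : T4Family) (N : ℕ) [NeZero N]

/-- ★★ **[15] THEOREM 1 (9), LINE 1 (p. 279), FOR CRITICAL CONFIGURATIONS (Sect. F p. 300 L19–21, (152) p. 301, (167) p. 304, (169) p. 305), AT THE OBJECTS OF
RECORD, AT A GENUINE STEP `k ≥ 1`, ON A TOP DOMAIN `Ω₀ = Sup ν K s.Ω`** — *«for an arbitrary cube □ in the class described above … there exists a gauge transformation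
u defined on a neighborhood of □ and such that on □, U^u = e^{iηA}, |A| < B₃Mε₁(L^jη)⁻¹, |∇^ηA| < B₃Mε₁(L^jη)⁻²»* —, in the binder block of this seat's
`Prop8RegSepTopStep F N Sup B₃ a₀ a₁` BYTE FOR BYTE (separated (2.18) index `s : SeqOfRecord F ν M g K k`, `0 < ν.M₁`, `1 ≤ k`, thresholds `0 < δ_n ≤ a₁`,
`B₃δ_n ≤ ε₀ ≤ a₀` comparable both ways, datum with print's (7) on the top domain, `U` in the class (6)-Top at `ε₀` on the fibre of `W`, CRITICAL for (5) on that fibre) except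
that [I]'s cube letter `M` is a PARAMETER of the `Prop` (print's constant `B₃·M` is proportional to the cube size: «|A|, |∇^ηA| < B₃Mε₁(L^jη)^{−1,−2}», `M ≤ M(ε₁)`),
conclusion IN SCALE-`n` UNITS (`L^jη = 1` at print's `j` = our `n`; node00-def-P11 ANSWER-M6 (B), the two cube families its row body reads): for every `1 ≤ n ≤ k` and
every cube side `S ∈ {Lⁿ·M, L^{n+1}·M}` (the [III] (2.38)(ii) layer cubes and the [I] (1.12) `O(1)LM`-cubes of record; `M` = [I]'s cube letter, a PARAMETER of the `Prop`
because print's constant `B₃·M` grows with the cube size) that does not wrap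
(`S < sitesPerDir`), every grid cube `□ = cubeEnl (F.P K) S a 0`, `a ∈ cubeIndices (F.P K) S`, with `□ ⊆ Ω_n` carries an `SU(N)`-valued gauge `u` and a potential
`A : bonds → M_N(ℂ)` with `(ιU)^{ιu}(b) = expI η_n (A b)` on the bonds of `Sect2.regionOfSet □`, `‖A b‖ < B₃'·δ_n` there, and `‖grad η_n μ A_ν x‖ < B₃'·δ_n` on its
derivative quadruples (`η_n = (F.P K).eta n`).  A `Prop` with parameters, NEVER asserted.  HONEST LABEL: verbatim (9) LINE 1 modulo (a) units (`A` here `= L^{n}`·print's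
`ηA∕η`… i.e. print's `A` at `L^jη = 1`), (b) the cube class — print states (9) on the collared cubes of pp. 278–279 (side `2ML^jη`, `M` a multiple of `R₁M₁`, `M ≤ M(ε₁) =
R₁M₁a₁∕ε₁`, concentric `(2M + 4R₁M₁)L^jη`-cube inside `B_j(Λ_j) ∪ B_{j+1}(Λ_{j+1})`, not inside `B_{j+1}(Λ_{j+1})`); a non-wrapping grid cube inside `Ω_n` without
that collar is covered by a class cube of scale `n − 1` (one-scale factors `L`, `L²` and `δ_{n−1} ≤ 2δ_n`) or of a deeper scale `m > n` (factors `(2∕L)^{m−n} ≤ 1`),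
and restricting `u` to a sub-cube keeps the bounds — `B₃'` ABSORBS print's `B₃·M` (layer cubes, `M` units of `T⁽ⁿ⁾`) resp. `B₃·LM` ((1.12) cubes) and these factors,
`a₁` absorbs `M ≤ M(ε₁)`; (c) `∃ A` with `expI η_n A = U^u` for print's logarithm `A`; (d) criticality in the CURVE form (`IsCritOnFibre`) — print's Sect. F uses the
(82) tangent form, GAP-STATED(submersion), ref-C READ-121 NOTE 2, as for `Prop8RegSepTopStep`; (e) the β-Hölder member of (9) and (10) are NOT part of this sentence
(no consumer on the (1.12)∕(2.38)(ii) road reads them; they are what print has INSTEAD of a curvature-derivative bound — LOCATED-M6).  Expected floor: `0 < B₃'`.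
-- TODO(general form): print states (9) for the logarithm `A` of `U^u` on the collared cube class of pp. 278–279 with ONE threshold ε₁, `M ≤ M(ε₁) = R₁M₁a₁∕ε₁`,
-- together with the β-Hölder member `|∇^ηA|_{β,□} < B₄(β₀)Mε₁(L^jη)^{−2−β}` (β ≤ β₀) and (10) `|∂^{η*}∂^ηA|, |Δ^ηA| < B₃Mε₁(L^jη)⁻³`; general admissible
-- `{Ω_j}` ∕ `𝔅_k` of [6] Sect. A; criticality in the (82) tangent form.
[cite: Balaban1985Variational, Thm 1 (9) p.279, pp.278–279 (cube class), Sect. F p.300 L19–21, (152) p.301, (161) p.303, (164)–(167) p.304, (169) p.305; Balaban1985RegularSpaces, (1.36) p.82, p.83 L1–9, Thm 2 p.83; Balaban1987RG1, (1.12) p.262; Balaban1988Convergent, (2.38) p.261] -/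
def Gauge9RegSepTopStep (Sup : (ν : Stage7Numerics) → (K : ℕ) → (ℕ → Set (Site (F.P K) 0)) → Set (Site (F.P K) 0)) (M : ℕ) (B₃ B₃' a₀ a₁ : ℝ) : Prop :=
  ∀ (ν : Stage7Numerics) (g : ℕ → ℝ) (K k : ℕ) (s : SeqOfRecord F ν M g K k), Sect2.SeqSeparated ν.M₁ s → 0 < ν.M₁ → 1 ≤ k →
    ∀ (ε₀ : ℝ) (δ : ℕ → ℝ),
    (∀ n, n ≤ k → 0 < δ n ∧ δ n ≤ a₁ ∧ B₃ * δ n ≤ ε₀) → (∀ n, n < k → δ n ≤ 2 * δ (n + 1)) → (∀ n, n < k → δ (n + 1) ≤ 2 * δ n) → ε₀ ≤ a₀ →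
    ∀ W : MSField (F.P K) (SU N), Sect2.DataSmall7PTop (avOfRecord F N K) s.Ω (Sup ν K s.Ω) k δ W →
      ∀ U : GaugeField (F.P K) 0 (SU N),
        (∀ n, n ≤ k → PlaqSmallOn (Sect2.omegaPlaqsTop s.Ω (Sup ν K s.Ω) n) (ε₀ * (F.P K).eta n ^ 2) U) →
        Sect2.CoDivClassOnTop s.Ω (Sup ν K s.Ω) k ε₀ U → AgreeOn (genSet s.Ω k) (avgFamily (avOfRecord F N K) U) W →
        IsCritOnFibre F N K (genSet s.Ω k) W U →
        ∀ n, 1 ≤ n → n ≤ k → ∀ S : ℕ,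
          (S = B14.Eq213MaximalDomains.side (F.P K).L M n ∨ S = B14.Eq213MaximalDomains.side (F.P K).L M (n + 1)) → (S : ℤ) < (F.P K).sitesPerDir 0 →
          ∀ a ∈ cubeIndices (F.P K) S, cubeEnl (F.P K) S a 0 ⊆ s.Ω n →
            ∃ u : GaugeTransf (F.P K) 0 (SU N), ∃ A : PBond (F.P K) 0 → MatA N,
              (∀ b ∈ (Sect2.regionOfSet (F.P K) (cubeEnl (F.P K) S a 0)).bonds,
                gaugeU (fun x => ιSU N (u x)) (fun b' => ιSU N (U b')) b = expI ((F.P K).eta n) (A b)) ∧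
              (∀ b ∈ (Sect2.regionOfSet (F.P K) (cubeEnl (F.P K) S a 0)).bonds, ‖A b‖ < B₃' * δ n) ∧
              ∀ q ∈ (Sect2.regionOfSet (F.P K) (cubeEnl (F.P K) S a 0)).dpairs,
                ‖grad ((F.P K).eta n) q.2.1 (fun y => A ⟨y, q.2.2⟩) q.1‖ < B₃' * δ n

variable {F N}

/-- The (9)-line-1 step fact is ANTITONE in the ceilings `a₀`, `a₁`. [cite: Balaban1985Variational, Thm 1 p.279 (the range «ε₀ ≤ a₀», «ε₁ ≤ a₁»; bookkeeping)] -/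
theorem Gauge9RegSepTopStep.of_le {Sup : (ν : Stage7Numerics) → (K : ℕ) → (ℕ → Set (Site (F.P K) 0)) → Set (Site (F.P K) 0)}
    {M : ℕ} {B₃ B₃' a₀ a₀' a₁ a₁' : ℝ} (h : Gauge9RegSepTopStep F N Sup M B₃ B₃' a₀ a₁) (ha₀ : a₀' ≤ a₀) (ha₁ : a₁' ≤ a₁) :
    Gauge9RegSepTopStep F N Sup M B₃ B₃' a₀' a₁' :=
  fun ν g K k s hsep hM₁ hk ε₀ δ hδ hcomp hcomp' hε₀ W h7 U h17 h19 hfib hcrit =>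
    h ν g K k s hsep hM₁ hk ε₀ δ (fun n hn => ⟨(hδ n hn).1, (hδ n hn).2.1.trans ha₁, (hδ n hn).2.2⟩) hcomp hcomp' (hε₀.trans ha₀) W h7 U h17 h19 hfib
      hcrit

/-- The (9)-line-1 step fact is MONOTONE in the constant `B₃'` (a larger constant is a weaker conclusion). [cite: Balaban1985Variational, Thm 1 (9) p.279 (bookkeeping)] -/
theorem Gauge9RegSepTopStep.mono {Sup : (ν : Stage7Numerics) → (K : ℕ) → (ℕ → Set (Site (F.P K) 0)) → Set (Site (F.P K) 0)}
    {M : ℕ} {B₃ B₃' B₃'' a₀ a₁ : ℝ} (h : Gauge9RegSepTopStep F N Sup M B₃ B₃' a₀ a₁) (hB : B₃' ≤ B₃'') :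
    Gauge9RegSepTopStep F N Sup M B₃ B₃'' a₀ a₁ := by
  intro ν g K k s hsep hM₁ hk ε₀ δ hδ hcomp hcomp' hε₀ W h7 U h17 h19 hfib hcrit n hn1 hnk S hS hSN a ha hΩ
  obtain ⟨u, A, hexp, hA, hgrad⟩ := h ν g K k s hsep hM₁ hk ε₀ δ hδ hcomp hcomp' hε₀ W h7 U h17 h19 hfib hcrit n hn1 hnk S hS hSN a ha hΩ
  have hB' : B₃' * δ n ≤ B₃'' * δ n := mul_le_mul_of_nonneg_right hB (hδ n hnk).1.le
  exact ⟨u, A, hexp, fun b hb => (hA b hb).trans_le hB', fun q hq => (hgrad q hq).trans_le hB'⟩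

end NamedFactGauge9Top

/-! ## §3  The minimiser form, and the chart from a group-level gauge to [I] (1.12)'s `∃ A` letters at any scale `ξ` -/

section Suppliers

variable {F : T4Family} {N : ℕ} [NeZero N]

/-- ★ **(9) LINE 1 FOR EVERY MINIMISER OVER PRINT'S CLASS (6) ON A TOP DOMAIN, FROM THE STEP FACT**: for `k ≥ 1`, a separated index, thresholds comparable both
ways, `0 < M₁`, a datum with print's (7) on `Ω₀`, a minimiser of (2.12) over the class (6)-Top at `ε₀` on the fibre of `W` is critical on the fibre
(`isCritOnFibre_of_isMinimizer_classTop`), so the fact applies: on every non-wrapping grid cube of the two families of record inside `Ω_n`, `1 ≤ n ≤ k`, a gauge `u` and a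
potential `A` with `(ιU₀)^{ιu} = expI η_n A`, `‖A‖ < B₃'δ_n`, `‖grad η_n A‖ < B₃'δ_n`.  (The Theorem-1-level token keyed on this is node00-def-P11's
`VariationalThm1GaugeRegSep{Top7M,CoP7M}`.) [cite: Balaban1985Variational, Thm 1 (6)–(9) pp.278–279, p.299, Sect. F p.300; Balaban1988Convergent, (2.12) p.256, (2.38) p.261; Balaban1987RG1, (1.12) p.262] -/
theorem gauge9_of_isMinimizer_classTop_of_gauge9TopStep
    {Sup : (ν : Stage7Numerics) → (K : ℕ) → (ℕ → Set (Site (F.P K) 0)) → Set (Site (F.P K) 0)} {M : ℕ} {B₃ B₃' a₀ a₁ : ℝ}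
    (h9 : Gauge9RegSepTopStep F N Sup M B₃ B₃' a₀ a₁) (ν : Stage7Numerics) (g : ℕ → ℝ) (K k : ℕ) (s : SeqOfRecord F ν M g K k)
    (hsep : Sect2.SeqSeparated ν.M₁ s) (hM₁ : 0 < ν.M₁) (hk : 1 ≤ k) (ε₀ : ℝ) (δ : ℕ → ℝ)
    (hδ : ∀ n, n ≤ k → 0 < δ n ∧ δ n ≤ a₁ ∧ B₃ * δ n ≤ ε₀) (hcomp : ∀ n, n < k → δ n ≤ 2 * δ (n + 1))
    (hcomp' : ∀ n, n < k → δ (n + 1) ≤ 2 * δ n) (hε₀ : ε₀ ≤ a₀)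
    (W : MSField (F.P K) (SU N)) (h7 : Sect2.DataSmall7PTop (avOfRecord F N K) s.Ω (Sup ν K s.Ω) k δ W) {U₀ : GaugeField (F.P K) 0 (SU N)}
    (hU₀ : IsMinimizer (avOfRecord F N K)
      {U | (∀ n, n ≤ k → PlaqSmallOn (Sect2.omegaPlaqsTop s.Ω (Sup ν K s.Ω) n) (ε₀ * (F.P K).eta n ^ 2) U) ∧
        Sect2.CoDivClassOnTop s.Ω (Sup ν K s.Ω) k ε₀ U} (genSet s.Ω k) W U₀)
    {n : ℕ} (hn1 : 1 ≤ n) (hnk : n ≤ k) {S : ℕ}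
    (hS : S = B14.Eq213MaximalDomains.side (F.P K).L M n ∨ S = B14.Eq213MaximalDomains.side (F.P K).L M (n + 1))
    (hSN : (S : ℤ) < (F.P K).sitesPerDir 0) {a : Fin (F.P K).d → ℤ} (ha : a ∈ cubeIndices (F.P K) S) (hΩ : cubeEnl (F.P K) S a 0 ⊆ s.Ω n) :
    ∃ u : GaugeTransf (F.P K) 0 (SU N), ∃ A : PBond (F.P K) 0 → MatA N,
      (∀ b ∈ (Sect2.regionOfSet (F.P K) (cubeEnl (F.P K) S a 0)).bonds,
        gaugeU (fun x => ιSU N (u x)) (fun b' => ιSU N (U₀ b')) b = expI ((F.P K).eta n) (A b)) ∧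
      (∀ b ∈ (Sect2.regionOfSet (F.P K) (cubeEnl (F.P K) S a 0)).bonds, ‖A b‖ < B₃' * δ n) ∧
      ∀ q ∈ (Sect2.regionOfSet (F.P K) (cubeEnl (F.P K) S a 0)).dpairs, ‖grad ((F.P K).eta n) q.2.1 (fun y => A ⟨y, q.2.2⟩) q.1‖ < B₃' * δ n :=
  h9 ν g K k s hsep hM₁ hk ε₀ δ hδ hcomp hcomp' hε₀ W h7 U₀ hU₀.1.1 hU₀.1.2 hU₀.2.1 (isCritOnFibre_of_isMinimizer_classTop hU₀) n hn1 hnk S hS hSN a ha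
    hΩ

/-- `dist1` on `SU(N)` is the operator-norm distance of the matrix to `1`. [cite: Balaban1985Averaging, (19) p.22 (bookkeeping)] -/
theorem dist1_su_eq_norm (g : SU N) : dist1 g = ‖(g : MatA N) - 1‖ := rfl

/-- ★★ **FROM A GROUP-LEVEL SMALL GAUGE TO THE `∃ A` LETTERS OF [I] (1.12) ∕ [III] (2.38)(ii) AT ANY CHART SCALE `ξ > 0`** (the passage a future DISCHARGE of the
fact from a gauge CONSTRUCTION — e.g. [6] Thm 2's gauge — takes): if an `SU(N)`-valued gauge `u` gives `dist1 (U^u(b)) < r₁` on the bonds with both ends in a site set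
`Y` and `‖U^u(x+e_μ, ν) − U^u(x, ν)‖ < r₂` on the derivative quadruples of `Y`, and `r₁ ≤ ½`, then with `A(b) := (iξ)⁻¹·log U^u(b)`: the embedded gauge `ιSU ∘ u`
is `G`-valued, `(ιU)^{ιu} = expI ξ A` on the bonds of `Sect2.regionOfSet Y`, `‖A b‖ ≤ 2r₁∕ξ` there, and `‖grad ξ μ A_ν x‖ ≤ 4r₂∕ξ²` on its dpairs (§1 chart).
With `r₁ = c·δ_nη_n`, `r₂ = c·δ_nη_n²`, `ξ = η_n` (print's `|ηA| < η·B₃Mε₁(Lⁿη)⁻¹`, `η²|∇^ηA| < η²·B₃Mε₁(Lⁿη)⁻²` at the group level): the scale-free `2c·δ_n`, `4c·δ_n`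
of §2's conclusion. [cite: Balaban1987RG1, (1.12) p.262; Balaban1988Convergent, (2.38) p.261; Balaban1985Variational, Thm 1 (9) p.279; Balaban1985RegularSpaces, Thm 2 p.83] -/
theorem localGauge_of_groupBounds {P : Params} {Y : Set (Site P 0)} {U : GaugeField P 0 (SU N)} {u : GaugeTransf P 0 (SU N)} {r₁ r₂ ξ : ℝ}
    (h1 : ∀ b : PBond P 0, b.src ∈ Y → b.tgt ∈ Y → dist1 (GaugeField.gaugeAct u U b) < r₁)
    (h2 : ∀ (x : Site P 0) (μ ν' : Fin P.d), x ∈ Y → x.shift μ ∈ Y → x.shift ν' ∈ Y → (x.shift μ).shift ν' ∈ Y →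
      ‖((GaugeField.gaugeAct u U ⟨x.shift μ, ν'⟩ : SU N) : MatA N) - ((GaugeField.gaugeAct u U ⟨x, ν'⟩ : SU N) : MatA N)‖ < r₂)
    (hr₁ : r₁ ≤ 1 / 2) (hξ : 0 < ξ) :
    (∀ x, (fun x => ιSU N (u x)) x ∈ (B12RegularSpaces111SpecialUnitary.suModel N).G) ∧
    ∃ A : PBond P 0 → MatA N,
      (∀ b ∈ (Sect2.regionOfSet P Y).bonds, gaugeU (fun x => ιSU N (u x)) (fun b' => ιSU N (U b')) b = expI ξ (A b)) ∧
      (∀ b ∈ (Sect2.regionOfSet P Y).bonds, ‖A b‖ ≤ 2 * r₁ / ξ) ∧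
      ∀ q ∈ (Sect2.regionOfSet P Y).dpairs, ‖grad ξ q.2.1 (fun y => A ⟨y, q.2.2⟩) q.1‖ ≤ 4 * r₂ / ξ ^ 2 := by
  set A : PBond P 0 → MatA N := fun b =>
    (I * (ξ : ℂ))⁻¹ • logOnePlus (((ιSU N (GaugeField.gaugeAct u U b) : (MatA N)ˣ) : MatA N) - 1) with hA
  have hsmall : ∀ b : PBond P 0, b.src ∈ Y → b.tgt ∈ Y →
      ‖((ιSU N (GaugeField.gaugeAct u U b) : (MatA N)ˣ) : MatA N) - 1‖ ≤ r₁ := fun b hs ht => by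
    rw [coe_ιSU, ← dist1_su_eq_norm]
    exact (h1 b hs ht).le
  refine ⟨fun x => ιSU_mem_G N _, A, fun b hb => ?_, fun b hb => ?_, fun q hq => ?_⟩
  · rw [gaugeU_ιSU]
    exact ((chart_of_groupBounds (hsmall b hb.1 hb.2) (hsmall b hb.1 hb.2) hr₁ hξ).1).symm
  · exact (chart_of_groupBounds (hsmall b hb.1 hb.2) (hsmall b hb.1 hb.2) hr₁ hξ).2.1
  · obtain ⟨hx, hxμ, hxν, hxμν⟩ := hq
    -- the two bonds `⟨x + e_μ, ν⟩` and `⟨x, ν⟩`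
    have hb1 : (⟨q.1.shift q.2.1, q.2.2⟩ : PBond P 0).src ∈ Y ∧ (⟨q.1.shift q.2.1, q.2.2⟩ : PBond P 0).tgt ∈ Y := ⟨hxμ, hxμν⟩
    have hb0 : (⟨q.1, q.2.2⟩ : PBond P 0).src ∈ Y ∧ (⟨q.1, q.2.2⟩ : PBond P 0).tgt ∈ Y := ⟨hx, hxν⟩
    have hc := (chart_of_groupBounds (hsmall _ hb1.1 hb1.2) (hsmall _ hb0.1 hb0.2) hr₁ hξ).2.2
    have hd := h2 q.1 q.2.1 q.2.2 hx hxμ hxν hxμν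
    rw [grad, norm_smul, norm_inv, Complex.norm_real, Real.norm_eq_abs, abs_of_pos hξ]
    rw [coe_ιSU, coe_ιSU] at hc
    calc ξ⁻¹ * ‖A ⟨q.1.shift q.2.1, q.2.2⟩ - A ⟨q.1, q.2.2⟩‖
        ≤ ξ⁻¹ * (4 * ‖((GaugeField.gaugeAct u U ⟨q.1.shift q.2.1, q.2.2⟩ : SU N) : MatA N) -
            ((GaugeField.gaugeAct u U ⟨q.1, q.2.2⟩ : SU N) : MatA N)‖ / ξ) :=
          mul_le_mul_of_nonneg_left hc (inv_nonneg.mpr hξ.le)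
      _ ≤ ξ⁻¹ * (4 * r₂ / ξ) := by gcongr
      _ = 4 * r₂ / ξ ^ 2 := by field_simp

end Suppliers


/-! ## §4  The gauge-fixing half: [15] (152) (= [6] Thm 2 applied on the collared cube) for configurations IN THE CLASS, criticality-free — the named fact
`Gauge152OfClassTopStep F N Sup M B₉ a₀` — and ★★★ the reduction `Gauge9RegSepTopStep ⟸ Prop8RegSepTopStep ∧ Gauge152OfClassTopStep` -/

section GaugeFixingHalf

variable (F : T4Family) (N : ℕ) [NeZero N]

/-- ★★ **[15] (152) p. 301, LINE 1 — [6] THEOREM 2 (p. 83) APPLIED TO `(U′_k, 1)` ON THE COLLARED CUBE — FOR CONFIGURATIONS IN PRINT'S CLASS (2)∕(6) ON A TOP DOMAIN,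
AT THE OBJECTS OF RECORD, with LEVEL-DEPENDENT thresholds comparable both ways** — *«Now we apply Theorem 2 of the paper [6] to the pair of configurations U′_k, 1 …
We assume that 9dL²Mε₀ ≦ c₁.  Then there exists a unique gauge transformation u … such that L^jη|A|, (L^jη)²|∇A|, (L^jη)³|∂*∂A|, (L^jη)³|ΔA| < 9dL²B₁Mε₀ on □′_j»* —:
for a separated (2.18) index with `0 < ν.M₁`, thresholds `0 < ε_m ≤ a₀` comparable both ways (`ε_m ≤ 2ε_{m+1}`, `ε_{m+1} ≤ 2ε_m`), and ANY configuration `U` with the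
class bounds (1.7) `PlaqSmallOn (omegaPlaqsTop … m) (ε_m·η_m²)` and (1.9) `CoDivSmallOn (omegaBondsTop … m) (ε_m·η_m³)` at every `m ≤ k` — NO criticality, NO datum,
NO fibre —: on every non-wrapping grid cube of the two families of record (sides `Lⁿ·M`, `L^{n+1}·M`) inside `Ω_n`, `1 ≤ n ≤ k`, an `SU(N)`-valued gauge `u` and a potential
`A` with `(ιU)^{ιu} = expI η_n A` on the cube's bonds, `‖A b‖ < B₉·ε_n`, `‖grad η_n μ A_ν x‖ < B₉·ε_n` on its derivative quadruples.  This is the GAUGE-FIXING half of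
[15] Thm 1 (9) line 1: print's proof of (9) (Sect. F) = this step at the class constant (uses only «U′_k belongs to the space (2)», the generalized axial gauge,
Prop. 2 of [4] for (145)–(146), the datum `V″` of (147)–(151) with `|V″ − 1| < 9dL²Mε₀`, and [6] Thm 2) FOLLOWED BY the improvement `ε₀ ↦ B₃ε₁` through (8)
(Prop. 8) and Eq. (158).  A `Prop` with parameters, NEVER asserted; the [B8]-node ([6]) content of the (9) road, displayed so that N07's own analytic debt on the
K0 road is Proposition 8 alone (★★★ below).  HONEST LABEL: consequence-form reading of (152) LINE 1 (the `|A|`, `|∇A|` members; `∂*∂A`, `ΔA` and (153) are not part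
of it) modulo units (scale `n`, `L^jη = 1`), the cube class (print: `□` meeting `Ω_j` not `Ω_{j+1}`, side `2ML^jη`, `M` a multiple of `R₁M₁`, the collared `□̃` with
`dist(□̃ᶜ… ) = 2R₁M₁L^jη` inside `B_{j−1}(Λ_{j−1}) ∪ B_j(Λ_j)`, (144) p.300 — vs every non-wrapping grid cube of the two families inside `Ω_n`; covering and one-scale
factors and `ε_{n±1} ≤ 2ε_n` ABSORBED into `B₉` together with print's `9dL²B₁M`), `∃ A` for print's logarithm, and the smallness «9dL²Mε₀ ≤ c₁» absorbed into `a₀`.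
Tree status of [6] Thm 2: `B8.Thm2Printed` over the abstract carrier `GFData` (node N05); its instantiation at NODE 00's gauge fields («[B8] Thm 2 as a map on the
objects of record») is not in the tree — this fact is the located shape that instantiation + (144)–(151) would prove.
-- TODO(general form): (152) in full (`∂*∂A`, `ΔA` members, all levels `j = 0, …, k` of the local sequence `{□′_j}`, the Landau condition (153) `R ∂*A = 0`, uniqueness
-- of `u` under `ū_j = 1` on `Λ′_j`), ONE threshold ε₀, general admissible `{Ω_j}` of [6] Sect. A.
[cite: Balaban1985Variational, (144)–(153) pp.300–301, (2) p.278, Thm 1 (9) p.279; Balaban1985RegularSpaces, Thm 2 (1.33)–(1.39) pp.82–83, (1.7)–(1.9) p.77; Balaban1987RG1, (1.12) p.262; Balaban1988Convergent, (2.38) p.261] -/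
def Gauge152OfClassTopStep (Sup : (ν : Stage7Numerics) → (K : ℕ) → (ℕ → Set (Site (F.P K) 0)) → Set (Site (F.P K) 0)) (M : ℕ) (B₉ a₀ : ℝ) : Prop :=
  ∀ (ν : Stage7Numerics) (g : ℕ → ℝ) (K k : ℕ) (s : SeqOfRecord F ν M g K k), Sect2.SeqSeparated ν.M₁ s → 0 < ν.M₁ → 1 ≤ k →
    ∀ (ε : ℕ → ℝ),
    (∀ m, m ≤ k → 0 < ε m ∧ ε m ≤ a₀) → (∀ m, m < k → ε m ≤ 2 * ε (m + 1)) → (∀ m, m < k → ε (m + 1) ≤ 2 * ε m) →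
      ∀ U : GaugeField (F.P K) 0 (SU N),
        (∀ m, m ≤ k → PlaqSmallOn (Sect2.omegaPlaqsTop s.Ω (Sup ν K s.Ω) m) (ε m * (F.P K).eta m ^ 2) U) →
        (∀ m, m ≤ k → Sect2.CoDivSmallOn (Sect2.omegaBondsTop s.Ω (Sup ν K s.Ω) m) (ε m * (F.P K).eta m ^ 3) U) →
        ∀ n, 1 ≤ n → n ≤ k → ∀ S : ℕ,
          (S = B14.Eq213MaximalDomains.side (F.P K).L M n ∨ S = B14.Eq213MaximalDomains.side (F.P K).L M (n + 1)) → (S : ℤ) < (F.P K).sitesPerDir 0 →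
          ∀ a ∈ cubeIndices (F.P K) S, cubeEnl (F.P K) S a 0 ⊆ s.Ω n →
            ∃ u : GaugeTransf (F.P K) 0 (SU N), ∃ A : PBond (F.P K) 0 → MatA N,
              (∀ b ∈ (Sect2.regionOfSet (F.P K) (cubeEnl (F.P K) S a 0)).bonds,
                gaugeU (fun x => ιSU N (u x)) (fun b' => ιSU N (U b')) b = expI ((F.P K).eta n) (A b)) ∧
              (∀ b ∈ (Sect2.regionOfSet (F.P K) (cubeEnl (F.P K) S a 0)).bonds, ‖A b‖ < B₉ * ε n) ∧
              ∀ q ∈ (Sect2.regionOfSet (F.P K) (cubeEnl (F.P K) S a 0)).dpairs,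
                ‖grad ((F.P K).eta n) q.2.1 (fun y => A ⟨y, q.2.2⟩) q.1‖ < B₉ * ε n

variable {F N}

/-- The gauge-fixing fact is ANTITONE in the ceiling `a₀`. [cite: Balaban1985Variational, (152) p.301 («9dL²Mε₀ ≦ c₁»; bookkeeping)] -/
theorem Gauge152OfClassTopStep.of_le {Sup : (ν : Stage7Numerics) → (K : ℕ) → (ℕ → Set (Site (F.P K) 0)) → Set (Site (F.P K) 0)} {M : ℕ} {B₉ a₀ a₀' : ℝ}
    (h : Gauge152OfClassTopStep F N Sup M B₉ a₀) (ha₀ : a₀' ≤ a₀) : Gauge152OfClassTopStep F N Sup M B₉ a₀' :=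
  fun ν g K k s hsep hM₁ hk ε hε hcomp hcomp' U h17 h19 =>
    h ν g K k s hsep hM₁ hk ε (fun m hm => ⟨(hε m hm).1, (hε m hm).2.trans ha₀⟩) hcomp hcomp' U h17 h19

/-- ★★★ **THE REDUCTION: (9) LINE 1 FOR CRITICAL POINTS ⟸ PROPOSITION 8 ∧ THE GAUGE-FIXING HALF** — print's own order of proof in Sect. F (p. 300 L19–21: criticality and
class membership only; (152) at the class constant; then (8)): a configuration critical on its fibre in the class (6)-Top with a (7)-datum lies in the class (8) at the
constants `B₃δ_m` (plaquettes AND co-divergence, `Prop8RegSepTopStep`); these thresholds are positive, `≤ B₃a₁ ≤ a₀'` and comparable both ways, so the gauge-fixing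
fact at `ε_m := B₃δ_m` gives the (9)-line-1 gauge with constant `B₉·B₃`.  Hence on the K0 road N07's own analytic debt is [15] Prop. 8; the (9) half is [6] Thm 2
applied locally ((144)–(152)). [cite: Balaban1985Variational, Sect. F pp.300–305, Prop. 8 p.304, (152) p.301, Thm 1 (8)–(9) p.279; Balaban1985RegularSpaces, Thm 2 p.83] -/
theorem gauge9RegSepTopStep_of_prop8TopStep_of_gauge152
    {Sup : (ν : Stage7Numerics) → (K : ℕ) → (ℕ → Set (Site (F.P K) 0)) → Set (Site (F.P K) 0)} {M : ℕ} {B₃ B₉ a₀ a₀' a₁ : ℝ}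
    (h8 : Prop8RegSepTopStep F N Sup B₃ a₀ a₁) (h152 : Gauge152OfClassTopStep F N Sup M B₉ a₀') (hB₃ : 0 < B₃) (ha : B₃ * a₁ ≤ a₀') :
    Gauge9RegSepTopStep F N Sup M B₃ (B₉ * B₃) a₀ a₁ := by
  intro ν g K k s hsep hM₁ hk ε₀ δ hδ hcomp hcomp' hε₀ W h7 U h17 h19 hfib hcrit n hn1 hnk S hS hSN a ha' hΩ
  obtain ⟨h8p, h8c⟩ := h8 ν M g K k s hsep hM₁ hk ε₀ δ hδ hcomp hcomp' hε₀ W h7 U h17 h19 hfib hcrit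
  have hε : ∀ m, m ≤ k → 0 < B₃ * δ m ∧ B₃ * δ m ≤ a₀' := fun m hm =>
    ⟨mul_pos hB₃ (hδ m hm).1, (mul_le_mul_of_nonneg_left (hδ m hm).2.1 hB₃.le).trans ha⟩
  have hc : ∀ m, m < k → B₃ * δ m ≤ 2 * (B₃ * δ (m + 1)) := fun m hm => by
    have := mul_le_mul_of_nonneg_left (hcomp m hm) hB₃.le
    linarith
  have hc' : ∀ m, m < k → B₃ * δ (m + 1) ≤ 2 * (B₃ * δ m) := fun m hm => by
    have := mul_le_mul_of_nonneg_left (hcomp' m hm) hB₃.le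
    linarith
  obtain ⟨u, A, hexp, hA, hgrad⟩ := h152 ν g K k s hsep hM₁ hk (fun m => B₃ * δ m) hε hc hc' U h8p h8c n hn1 hnk S hS hSN a ha' hΩ
  refine ⟨u, A, hexp, fun b hb => ?_, fun q hq => ?_⟩
  · calc ‖A b‖ < B₉ * (B₃ * δ n) := hA b hb
      _ = B₉ * B₃ * δ n := by ring
  · calc ‖grad ((F.P K).eta n) q.2.1 (fun y => A ⟨y, q.2.2⟩) q.1‖ < B₉ * (B₃ * δ n) := hgrad q hq
      _ = B₉ * B₃ * δ n := by ring

end GaugeFixingHalf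

end Literature.MathematicalPhysics.QuantumFieldTheory.Balaban1983to89.Node00

end
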